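import Summits.ValiantsHypothesis.ValiantsHypothesis.Theorems.DivisionGapShadowCofactorSplit
import Literature.Computability.AlgebraicComplexity.PermanentIrreducible
import Literature.Computability.AlgebraicComplexity.StandardFamiliesProofs

/-!
# Crux `DivisionGap.PerCofactorDegreeReduction` (stmt-ValiantsHypothesis-15046), line `Sketch` —
# stub `stub_shadowCreationSplit`: the route needs only the field-side half K1

**Theorem (`stub_shadowCreationSplit`).** `ShadowBirkhoff → K1 → PerMultiplesHard`, where K1 is
the field-side half of the crux: a nonzero `g ∈ per_n · ℝ≥0[x]` yields a nonzero `A ∈ ℝ≥0[x]` with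
`per_n ∣ A` OVER `ℝ` (signed cofactor allowed) and `deg A, L₊(A) ≤ 2^((log₂ n + log₂ L₊(g) + k)^k)`,
`L₊ = complexity` over the semiring `ℝ≥0`.  This is the glue `shadowCofactorSplit_proof`
(`ShadowBirkhoff → PerCofactorDegreeReduction → PerMultiplesHard`, item 15047,
`Theorems/DivisionGapShadowCofactorSplit.lean`) re-proved from the weaker hypothesis K1:
Hrubeš–Yehudayoff's Thm. 42 is stated for "a monotone `g ≠ 0` such that `f` divides `g`" — the
cofactor may be SIGNED.  The one use of a nonnegative cofactor in the original glue, the Minkowski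
step `sh_le_sh_mul` (`mon(per · h') = mon per + mon h'` over `ℝ≥0`), is replaced by the Minkowski
step over the DOMAIN `ℝ[x]` (pencil rendering of the tree: `UM[c, d, X]` = points of `X` uniquely
maximising some `c + t·d`, pencil count `SH[φ, c, d, f] = |UM(φ(mon f))|`; local notation only):

* `add_mem_pts_mul` — **initial forms multiply**: for the unique maximisers `p` over `φ(mon f)` and
  `b` over `φ(mon g)` of `c + t·d` (`f, g ∈ ℝ[x]`), `p + b ∈ φ(mon (f · g))`: the restrictions
  `P = f|_{φ = p}`, `Q = g|_{φ = b}` are nonzero, so `P · Q ≠ 0` has a monomial `m₀ ∈ mon P + mon Q`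
  (`φ m₀ = p + b`), and `(f · g)_{m₀} = (P · Q)_{m₀}` since a pair `m₁ + m₂ = m₀`,
  `f_{m₁} g_{m₂} ≠ 0`, has `ℓ(φ m₁) ≤ ℓ(p)`, `ℓ(φ m₂) ≤ ℓ(b)` with sum `ℓ(p) + ℓ(b)`;
* `sh_le_sh_mul_real` — `|UM(φ(mon f))| ≤ |UM(φ(mon (f · g)))|` for `g ≠ 0` along a separating
  pencil (the injection `p ↦ p + b_p` of `ncard_um_le_ncard_um_add`, target
  `φ(mon (f · g)) ⊆ φ(mon f) + φ(mon g)`);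
* `sh_perPoly_le_sh_of_dvd`, `ncard_extremePoints_le_of_idealMember` — **HY21 Thm. 42, Birkhoff
  instance, ideal form**: for `A ∈ ℝ≥0[x]` nonzero with `per_n ∣ A` over `ℝ`, every shadow `L(DS_n)`
  has at most `4(3·E₊(A) + 1)` vertices, `E₊ = formulaComplexity` over `ℝ≥0`;
* `stub_shadowCreationSplit` — the exponent bookkeeping of `shadowCofactorSplit_proof`
  (`exists_exponent`, `formulaComplexity_le_two_pow`), with `deg A ≤ 2^{E₁}` directly.

References: P. Hrubeš, A. Yehudayoff, *Shadows of Newton polytopes*, CCC 2021, LIPIcs 200:9,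
Lemma 12, Thm. 42 [HrubesYehudayoff2021]; P. Bürgisser, M. Clausen, M. A. Shokrollahi, *Algebraic
Complexity Theory*, Springer 1997, Thm. (21.35)/(21.36) [BurgisserClausenShokrollahi1997].
-/

noncomputable section

-- `Summit.ValiantsHypothesis.ValiantsHypothesis.…` is the tree's mandated single-conjunct layout
-- (Problem = Summit), so the duplicated namespace component is intended.
set_option linter.dupNamespace false

namespace Summit.ValiantsHypothesis.ValiantsHypothesis.Theorems.DivisionGap.PerCofactorDegreeReduction.ShadowCreationSplit

open MvPolynomial Literature.Computability.AlgebraicComplexity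
open scoped NNReal Pointwise
open Literature.Barriers.ValiantsHypothesis.JerrumSnir
open Summit.ValiantsHypothesis.DivisionGap.ShadowDegreeSplit
open Summit.ValiantsHypothesis.ValiantsHypothesis.Theorems.DivisionGap.ShadowCofactorSplit

local notation3 (prettyPrint := false) "UM[" c ", " d ", " X "]" =>
  {p | p ∈ X ∧ ∃ t : ℝ, ∀ q ∈ X, q ≠ p → c q + t * d q < c p + t * d p}

local notation3 (prettyPrint := false) "PT[" φ ", " f "]" =>
  (⇑φ) '' ((MvPolynomial.support f : Finset _) : Set _)

local notation3 (prettyPrint := false) "SH[" φ ", " c ", " d ", " f "]" =>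
  Set.ncard {p | p ∈ PT[φ, f] ∧ ∃ t : ℝ, ∀ q ∈ PT[φ, f], q ≠ p → c q + t * d q < c p + t * d p}

/-! ### Part 1. The Minkowski step over the domain `ℝ[x]`: initial forms multiply -/

section Pencil

variable {σ G : Type*} [AddCommGroup G] (φ : (σ →₀ ℕ) →+ G) (c d : G →+ ℝ)

/-- **Restriction to a fibre of `φ`.** The coefficients of `f|_p := Σ_{m ∈ mon f, φ m = p} f_m x^m`
are `[φ m = p] · f_m`. [folklore] -/
theorem coeff_fibre [DecidableEq G] (f : MvPolynomial σ ℝ) (p : G) (m : σ →₀ ℕ) :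
    coeff m (∑ m' ∈ f.support.filter (fun m' => φ m' = p), monomial m' (coeff m' f)) =
      if φ m = p then coeff m f else 0 := by
  classical
  simp only [coeff_sum, coeff_monomial, Finset.sum_ite_eq', Finset.mem_filter]
  by_cases hm : m ∈ f.support
  · simp only [hm, true_and]
  · simp only [hm, false_and, notMem_support_iff.1 hm, ite_self]

/-- **Initial forms multiply (the Minkowski step of HY21 Lemma 12 over the domain `ℝ[x]`).**
For `f, g ∈ ℝ[x]`, an additive `φ` on exponents and a pencil parameter `t`: if `p` is the unique
maximiser of `c + t·d` over `φ(mon f)` and `b` the unique maximiser over `φ(mon g)`, then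
`p + b ∈ φ(mon (f · g))`.  The restrictions `P = f|_{φ = p}`, `Q = g|_{φ = b}` are nonzero, so
`P · Q` has a monomial `m₀ ∈ mon P + mon Q` (`φ m₀ = p + b`), and `(f · g)_{m₀} = (P · Q)_{m₀} ≠ 0`:
a contributing pair `m₁ + m₂ = m₀` has `ℓ(φ m₁) ≤ ℓ(p)`, `ℓ(φ m₂) ≤ ℓ(b)` summing to
`ℓ(p) + ℓ(b)`, so `φ m₁ = p` and `φ m₂ = b`. [cite: HrubesYehudayoff2021, Lemma 12] -/
theorem add_mem_pts_mul (f g : MvPolynomial σ ℝ) (t : ℝ) {p b : G}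
    (hp : p ∈ PT[φ, f]) (hpmax : ∀ x ∈ PT[φ, f], x ≠ p → c x + t * d x < c p + t * d p)
    (hb : b ∈ PT[φ, g]) (hbmax : ∀ x ∈ PT[φ, g], x ≠ b → c x + t * d x < c b + t * d b) :
    p + b ∈ PT[φ, f * g] := by
  classical
  obtain ⟨m₁, hm₁, rfl⟩ := hp
  obtain ⟨m₂, hm₂, rfl⟩ := hb
  -- the restrictions of `f`, `g` to the fibres of `φ` over the two maximisers
  set P : MvPolynomial σ ℝ := ∑ m ∈ f.support.filter (fun m => φ m = φ m₁), monomial m (coeff m f)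
  set Q : MvPolynomial σ ℝ := ∑ m ∈ g.support.filter (fun m => φ m = φ m₂), monomial m (coeff m g)
  have hPc : ∀ m, coeff m P = if φ m = φ m₁ then coeff m f else 0 := coeff_fibre φ f (φ m₁)
  have hQc : ∀ m, coeff m Q = if φ m = φ m₂ then coeff m g else 0 := coeff_fibre φ g (φ m₂)
  have hP0 : P ≠ 0 := fun h =>
    mem_support_iff.1 (Finset.mem_coe.1 hm₁) (by simpa [h] using (hPc m₁).symm)
  have hQ0 : Q ≠ 0 := fun h =>
    mem_support_iff.1 (Finset.mem_coe.1 hm₂) (by simpa [h] using (hQc m₂).symm)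
  obtain ⟨m₀, hm₀⟩ := support_nonempty.2 (mul_ne_zero hP0 hQ0)
  obtain ⟨a, ha, e, he, hae⟩ := Finset.mem_add.1 (support_mul P Q hm₀)
  have hφa : φ a = φ m₁ := by
    by_contra hne
    exact mem_support_iff.1 ha (by rw [hPc, if_neg hne])
  have hφe : φ e = φ m₂ := by
    by_contra hne
    exact mem_support_iff.1 he (by rw [hQc, if_neg hne])
  have hφ₀ : φ m₀ = φ m₁ + φ m₂ := by rw [← hae, map_add, hφa, hφe]
  -- the coefficients of `f · g` and `P · Q` at `m₀` agree term by term
  have hcoeff : coeff m₀ (f * g) = coeff m₀ (P * Q) := by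
    rw [coeff_mul, coeff_mul]
    refine Finset.sum_congr rfl fun x hx => ?_
    have hx' : x.1 + x.2 = m₀ := Finset.HasAntidiagonal.mem_antidiagonal.1 hx
    rw [hPc, hQc]
    by_cases h1 : coeff x.1 f = 0
    · rw [h1, zero_mul]; split_ifs <;> simp
    by_cases h2 : coeff x.2 g = 0
    · rw [h2, mul_zero]; split_ifs <;> simp
    have hx1 : φ x.1 ∈ PT[φ, f] := ⟨x.1, Finset.mem_coe.2 (mem_support_iff.2 h1), rfl⟩
    have hx2 : φ x.2 ∈ PT[φ, g] := ⟨x.2, Finset.mem_coe.2 (mem_support_iff.2 h2), rfl⟩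
    have i1 : c (φ x.1) + t * d (φ x.1) ≤ c (φ m₁) + t * d (φ m₁) :=
      (eq_or_ne (φ x.1) (φ m₁)).elim (fun h => by rw [h]) fun h => (hpmax _ hx1 h).le
    have i2 : c (φ x.2) + t * d (φ x.2) ≤ c (φ m₂) + t * d (φ m₂) :=
      (eq_or_ne (φ x.2) (φ m₂)).elim (fun h => by rw [h]) fun h => (hbmax _ hx2 h).le
    have h12 : φ x.1 + φ x.2 = φ m₁ + φ m₂ := by rw [← map_add, hx', hφ₀]
    have hc' : c (φ x.1) + c (φ x.2) = c (φ m₁) + c (φ m₂) := by rw [← map_add, h12, map_add]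
    have hd' : d (φ x.1) + d (φ x.2) = d (φ m₁) + d (φ m₂) := by rw [← map_add, h12, map_add]
    have hsum : c (φ x.1) + t * d (φ x.1) + (c (φ x.2) + t * d (φ x.2)) =
        c (φ m₁) + t * d (φ m₁) + (c (φ m₂) + t * d (φ m₂)) := by
      linear_combination hc' + t * hd'
    have e1 : c (φ x.1) + t * d (φ x.1) = c (φ m₁) + t * d (φ m₁) := by linarith
    have e2 : c (φ x.2) + t * d (φ x.2) = c (φ m₂) + t * d (φ m₂) := by linarith
    have hφ1 : φ x.1 = φ m₁ := by_contra fun hne => (hpmax _ hx1 hne).ne e1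
    have hφ2 : φ x.2 = φ m₂ := by_contra fun hne => (hbmax _ hx2 hne).ne e2
    rw [if_pos hφ1, if_pos hφ2]
  refine ⟨m₀, ?_, hφ₀⟩
  rw [Finset.mem_coe, mem_support_iff, hcoeff]
  exact mem_support_iff.1 hm₀

/-- **A divisor has at most as many uniquely supported points, over the domain `ℝ[x]`** (pencil
form of HY21 Lemma 12: `|vert Newt(f)| ≤ |vert Newt(f · g)|`).  If `g ≠ 0` and the pencil `(c, d)`
separates the points of `G`, then the pencil count of `φ(mon f)` is at most that of
`φ(mon (f · g))`: perturb the parameter so that the maximiser `b_p` over `φ(mon g)` is unique too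
(`isOpen_params`, finitely many ties); then `p ↦ p + b_p` is injective, lands in `φ(mon (f · g))`
(`add_mem_pts_mul`) and `p + b_p` is the unique maximiser there, since
`φ(mon (f · g)) ⊆ φ(mon f) + φ(mon g)` (`support_mul`). [cite: HrubesYehudayoff2021, Lemma 12] -/
theorem sh_le_sh_mul_real [DecidableEq σ] (f g : MvPolynomial σ ℝ) (hg : g ≠ 0)
    (hsep : ∀ b b' : G, c b = c b' → d b = d b' → b = b') :
    SH[φ, c, d, f] ≤ SH[φ, c, d, f * g] := by
  set A : Set G := PT[φ, f] with hAdef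
  set B : Set G := PT[φ, g] with hBdef
  set Z : Set G := PT[φ, f * g]
  have hA : A.Finite := (Finset.finite_toSet _).image _
  have hB : B.Finite := (Finset.finite_toSet _).image _
  have hBne : B.Nonempty := (Finset.coe_nonempty.2 (support_nonempty.2 hg)).image _
  have hZsub : Z ⊆ A + B := by
    rw [hAdef, hBdef, ← Set.image_add, ← Finset.coe_add]
    exact Set.image_mono (Finset.coe_subset.2 (support_mul f g))
  -- the finitely many parameters at which two separated points of `B` tie
  set Bad : Set ℝ := (fun bb : G × G => (c bb.2 - c bb.1) / (d bb.1 - d bb.2)) '' (B ×ˢ B)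
  have hBadfin : Bad.Finite := (hB.prod hB).image _
  -- for every uniquely supported point of `A`, a good parameter and the maximiser over `B`
  have key : ∀ p ∈ UM[c, d, A], ∃ t : ℝ, ∃ b : G,
      (∀ q ∈ A, q ≠ p → c q + t * d q < c p + t * d p) ∧ b ∈ B ∧
        (∀ b' ∈ B, b' ≠ b → c b' + t * d b' < c b + t * d b) := by
    rintro p ⟨hpA, t₀, ht₀⟩
    have hinf :
        ({t : ℝ | ∀ q ∈ A, q ≠ p → c q + t * d q < c p + t * d p} \ Bad).Infinite :=
      (infinite_of_isOpen (isOpen_params c d A hA p) ht₀).sdiff hBadfin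
    obtain ⟨t, ht, htBad⟩ := hinf.nonempty
    obtain ⟨b, hbB, hbmax⟩ := Set.exists_max_image B (fun b => c b + t * d b) hB hBne
    refine ⟨t, b, ht, hbB, fun b' hb' hne => ?_⟩
    refine lt_of_le_of_ne (hbmax b' hb') fun heq => ?_
    by_cases hd : d b' = d b
    · have hc : c b' = c b := by rw [hd] at heq; linarith
      exact hne (hsep b' b hc hd)
    · refine htBad ⟨(b', b), Set.mk_mem_prod hb' hbB, ?_⟩
      have hd' : d b' - d b ≠ 0 := sub_ne_zero.2 hd
      field_simp
      linarith
  choose! tt bb htt hbbB hbb using key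
  -- the injection `p ↦ p + b_p`, landing in `Z = φ(mon (f · g))` by `add_mem_pts_mul`
  have hmaps : Set.MapsTo (fun p => p + bb p) UM[c, d, A] UM[c, d, Z] := by
    intro p hp
    have hpA : p ∈ A := hp.1
    refine ⟨add_mem_pts_mul φ c d f g (tt p) hpA (htt p hp) (hbbB p hp) (hbb p hp), tt p,
      fun q hq hne => ?_⟩
    obtain ⟨a, ha, b, hb, rfl⟩ := Set.mem_add.1 (hZsub hq)
    have h1 : c a + tt p * d a ≤ c p + tt p * d p :=
      (eq_or_ne a p).elim (fun h => by rw [h]) fun h => (htt p hp a ha h).le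
    have h2 : c b + tt p * d b ≤ c (bb p) + tt p * d (bb p) :=
      (eq_or_ne b (bb p)).elim (fun h => by rw [h]) fun h => (hbb p hp b hb h).le
    have h3 : c a + tt p * d a < c p + tt p * d p ∨
        c b + tt p * d b < c (bb p) + tt p * d (bb p) := by
      by_cases hap : a = p
      · right
        have hbp : b ≠ bb p := fun hbp => hne (by rw [hap, hbp])
        exact hbb p hp b hb hbp
      · exact Or.inl (htt p hp a ha hap)
    simp only [map_add]
    rcases h3 with h3 | h3 <;> nlinarith
  have hinjOn : Set.InjOn (fun p => p + bb p) UM[c, d, A] := by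
    intro p hp p' hp' heq
    by_contra hne
    have h1 : c p' + tt p * d p' < c p + tt p * d p := htt p hp p' hp'.1 (Ne.symm hne)
    have h2 : c (bb p') + tt p * d (bb p') ≤ c (bb p) + tt p * d (bb p) :=
      (eq_or_ne (bb p') (bb p)).elim (fun h => by rw [h])
        fun h => (hbb p hp (bb p') (hbbB p' hp') h).le
    have h3 : c (p' + bb p') + tt p * d (p' + bb p') = c (p + bb p) + tt p * d (p + bb p) := by
      simp only at heq
      rw [heq]
    simp only [map_add] at h3
    nlinarith
  exact Set.ncard_le_ncard_of_injOn _ hmaps hinjOn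
    (((Finset.finite_toSet _).image _).subset (HrubesYehudayoff2021Prop23.um_subset c d Z))

end Pencil

/-! ### Part 2. The Birkhoff shadow under a cheap nonnegative ideal member -/

section Birkhoff

variable {G : Type*} [AddCommGroup G]

/-- **The permanent inside a nonnegative ideal member.** If `A ∈ ℝ≥0[x]` is nonzero and
`per_n ∣ A` over `ℝ` (the cofactor may be signed), then along every separating pencil the pencil
count of `φ(mon per_n)` is at most that of `φ(mon A)`: the monomial sets of `per_n` and of `A` do
not depend on the coefficient semiring (`support_perPoly`, `support_map_of_injective`), and over
`ℝ` this is `sh_le_sh_mul_real`. [cite: HrubesYehudayoff2021, Lemma 12] -/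
theorem sh_perPoly_le_sh_of_dvd {n : ℕ} (φ : (Fin n × Fin n →₀ ℕ) →+ G) (c d : G →+ ℝ)
    (A : MvPolynomial (Fin n × Fin n) ℝ≥0) (hA : A ≠ 0)
    (hdvd : perPoly (Fin n) ℝ ∣ MvPolynomial.map NNReal.toRealHom A)
    (hsep : ∀ b b' : G, c b = c b' → d b = d b' → b = b') :
    SH[φ, c, d, perPoly (Fin n) ℝ≥0] ≤ SH[φ, c, d, A] := by
  classical
  obtain ⟨q, hq⟩ := hdvd
  have hinj : Function.Injective (NNReal.toRealHom : ℝ≥0 → ℝ) := NNReal.coe_injective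
  have hq0 : q ≠ 0 := by
    rintro rfl
    rw [mul_zero] at hq
    exact hA (map_injective _ hinj (by rw [hq, map_zero]))
  have hper : (perPoly (Fin n) ℝ≥0).support = (perPoly (Fin n) ℝ).support := by
    rw [support_perPoly ℝ≥0, support_perPoly ℝ]
  have hAs : A.support = (perPoly (Fin n) ℝ * q).support := by
    rw [← hq, support_map_of_injective A hinj]
  rw [hper, hAs]
  exact sh_le_sh_mul_real φ c d _ q hq0 hsep

/-- **HY21 Thm. 42 for the tree's formula model, Birkhoff instance, ideal form.** If `A ∈ ℝ≥0[x]`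
is nonzero and `per_n ∣ A` over `ℝ`, then for every linear `L : ℝ^{n×n} → ℝ²` the shadow polygon
`L(DS_n)` has at most `4 · (3·E₊(A) + 1)` vertices, `E₊ = formulaComplexity` over `ℝ≥0` (monotone
fan-in-two formula size): every vertex is uniquely supported by one of four separating pencils
(`ncard_extremePoints_le_of_separating_pencils`), along which
`|UM(L(mon per_n))| ≤ |UM(L(mon A))| ≤ 3·E₊(A) + 1` (`sh_perPoly_le_sh_of_dvd`, `sh_eval_le`).
[cite: HrubesYehudayoff2021, Thm. 42 (= Thm. 1 with Lemma 12)] -/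
theorem ncard_extremePoints_le_of_idealMember {n : ℕ}
    (L : (Fin n × Fin n → ℝ) →ₗ[ℝ] (Fin 2 → ℝ)) (A : MvPolynomial (Fin n × Fin n) ℝ≥0)
    (hA : A ≠ 0) (hdvd : perPoly (Fin n) ℝ ∣ MvPolynomial.map NNReal.toRealHom A) :
    (Set.extremePoints ℝ (convexHull ℝ (L '' permMatrixPoints n))).ncard ≤
      4 * (3 * formulaComplexity A + 1) := by
  classical
  -- the additive map: exponent vector ↦ `L` of the corresponding real point
  let φ : (Fin n × Fin n →₀ ℕ) →+ (Fin 2 → ℝ) := L.toAddMonoidHom.comp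
    ((((Nat.castAddMonoidHom ℝ).compLeft (Fin n × Fin n))).comp Finsupp.coeFnAddHom)
  have hφ : ∀ m : Fin n × Fin n →₀ ℕ, φ m = L (fun ij => ((m ij : ℕ) : ℝ)) := fun _ => rfl
  -- its values on permutation monomials are the projected permutation matrices
  have hφM : ∀ ρ : Equiv.Perm (Fin n),
      φ (permMonomial ρ) = L (fun ij => if ρ ij.2 = ij.1 then 1 else 0) := by
    intro ρ
    rw [hφ]
    congr 1
    funext ij
    obtain ⟨r, s⟩ := ij
    rw [permMonomial_apply]
    split_ifs <;> simp
  have hPT : PT[φ, perPoly (Fin n) ℝ≥0] = L '' permMatrixPoints n := by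
    rw [support_perPoly ℝ≥0, Finset.coe_image, Finset.coe_univ, Set.image_univ, ← Set.range_comp]
    ext p
    simp only [Set.mem_range, permMatrixPoints, Set.mem_image, Set.mem_setOf_eq,
      Function.comp_apply]
    constructor
    · rintro ⟨ρ, rfl⟩
      exact ⟨_, ⟨ρ, rfl⟩, (hφM ρ).symm⟩
    · rintro ⟨_, ⟨ρ, rfl⟩, rfl⟩
      exact ⟨ρ, hφM ρ⟩
  -- an optimal monotone formula for `A`
  obtain ⟨P, hF, hfan, hcomp, hsize⟩ := ArithCircuit.exists_computes_size_eq_formulaComplexity A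
  have hfin : (L '' permMatrixPoints n).Finite := by
    rw [← hPT]
    exact finite_pts φ _
  refine ncard_extremePoints_le_of_separating_pencils _ hfin _ fun c d hsep => ?_
  rw [← hPT]
  calc SH[φ, c, d, perPoly (Fin n) ℝ≥0]
      ≤ SH[φ, c, d, A] := sh_perPoly_le_sh_of_dvd φ c d A hA hdvd hsep
    _ = SH[φ, c, d, P.eval] := by rw [show P.eval = A from hcomp]
    _ ≤ 3 * P.size + 1 := sh_eval_le φ c d P hF hfan
    _ = 3 * formulaComplexity A + 1 := by rw [hsize]

end Birkhoff

/-! ### Part 3. The stub -/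

section Main

open Summit.ValiantsHypothesis.ValiantsHypothesis.Theses.DivisionGap

/-- **The stub (the route needs only K1): `ShadowBirkhoff → K1 → PerMultiplesHard`.**

Suppose `PerMultiplesHard` fails: for some `c` and arbitrarily large `n` there is `h ≠ 0` with
`s = L₊(per_n · h) ≤ 2^((log₂ n + c)^c)`.  K1 (exponent `k`) applied to `g = per_n · h`
(`≠ 0`, `per_n ∣ g`) gives a nonzero `A ≥ 0` with `per_n ∣ A` over `ℝ`, `deg A ≤ 2^{E₁}` and
`L₊(A) ≤ 2^{E₁}`, `E₁ = (log₂ n + log₂ s + k)^k ≤ E₂ = (log₂ n + (log₂ n + c)^c + k)^k`.  With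
`E = E₂ + 2 log₂ n + 3` one has `deg A ≤ 2^{E₂} < 2^E`, `n² ≤ 2^E`, `L₊(A) ≤ 2^E`, so the balancing
theorem `formulaComplexity_le_two_pow` (Hyafil / Valiant–Skyum–Berkowitz–Rackoff with Brent, over
the commutative semiring `ℝ≥0`, hence monotone) gives a monotone formula for `A` of size
`≤ 2^{18E²}`.  By `ncard_extremePoints_le_of_idealMember` (HY21 Thm. 42 with a SIGNED cofactor)
EVERY shadow `L(DS_n)` then has at most `4(3·2^{18E²} + 1) ≤ 2^{18E² + 4} ≤ 2^((log₂ n + c₂)^{c₂})`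
vertices (`exists_exponent`), contradicting `ShadowBirkhoff` at exponent `c₂` for the `n ≥ n₀(c₂)`
supplied by the failure of `PerMultiplesHard`.
[cite: HrubesYehudayoff2021, Thm. 42; BurgisserClausenShokrollahi1997, Thm. (21.35)/(21.36)] -/
theorem stub_shadowCreationSplit
    (hSB : Summit.ValiantsHypothesis.ValiantsHypothesis.Theses.DivisionGap.ShadowBirkhoff)
    (hK1 : ∃ k : ℕ, ∀ (n : ℕ) (g : MvPolynomial (Fin n × Fin n) ℝ≥0), g ≠ 0 →
      perPoly (Fin n) ℝ≥0 ∣ g →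
      ∃ A : MvPolynomial (Fin n × Fin n) ℝ≥0, A ≠ 0 ∧
        perPoly (Fin n) ℝ ∣ MvPolynomial.map NNReal.toRealHom A ∧
        A.totalDegree ≤ 2 ^ ((Nat.log 2 n + Nat.log 2 (complexity g) + k) ^ k) ∧
        complexity A ≤ 2 ^ ((Nat.log 2 n + Nat.log 2 (complexity g) + k) ^ k)) :
    Summit.ValiantsHypothesis.ValiantsHypothesis.Theses.DivisionGap.PerMultiplesHard := by
  unfold ShadowBirkhoff at hSB
  unfold PerMultiplesHard
  by_contra hPMH
  push Not at hPMH
  obtain ⟨c, hc⟩ := hPMH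
  obtain ⟨k, hk⟩ := hK1
  obtain ⟨c₂, hc₂⟩ := exists_exponent c k
  obtain ⟨n₀, hn₀⟩ := hSB c₂
  obtain ⟨n, hn, h, hh, hs⟩ := hc n₀
  obtain ⟨L, hL⟩ := hn₀ n hn
  obtain ⟨A, hA0, hAdvd, hdeg, hcomp⟩ := hk n (perPoly (Fin n) ℝ≥0 * h)
    (mul_ne_zero (perPoly_ne_zero _ _) hh) (dvd_mul_right _ _)
  -- abbreviations
  set s := complexity (perPoly (Fin n) ℝ≥0 * h)
  set ℓ := Nat.log 2 n
  set M := (ℓ + c) ^ c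
  have hlog : Nat.log 2 s ≤ M :=
    (Nat.log_mono_right hs).trans_eq (Nat.log_pow Nat.one_lt_two M)
  set E₁ := (ℓ + Nat.log 2 s + k) ^ k
  set E₂ := (ℓ + M + k) ^ k
  have hE₁₂ : E₁ ≤ E₂ := Nat.pow_le_pow_left (by omega) k
  set E := E₂ + 2 * ℓ + 3
  -- the hypotheses of the balancing theorem
  have hnlt : n < 2 ^ (ℓ + 1) := Nat.lt_pow_succ_log_self Nat.one_lt_two n
  have hd : 2 ^ E₂ < 2 ^ E := Nat.pow_lt_pow_right Nat.one_lt_two (by omega)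
  have hcard : Fintype.card (Fin n × Fin n) ≤ 2 ^ E := by
    rw [Fintype.card_prod, Fintype.card_fin]
    calc n * n ≤ 2 ^ (ℓ + 1) * 2 ^ (ℓ + 1) := Nat.mul_le_mul hnlt.le hnlt.le
      _ = 2 ^ (ℓ + 1 + (ℓ + 1)) := (pow_add 2 _ _).symm
      _ ≤ 2 ^ E := Nat.pow_le_pow_right Nat.two_pos (by omega)
  have hdeg' : A.totalDegree ≤ 2 ^ E₂ := hdeg.trans (Nat.pow_le_pow_right Nat.two_pos hE₁₂)
  have hL' : complexity A ≤ 2 ^ E :=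
    hcomp.trans ((Nat.pow_le_pow_right Nat.two_pos hE₁₂).trans
      (Nat.pow_le_pow_right Nat.two_pos (by omega)))
  have hfc := formulaComplexity_le_two_pow hdeg' hd hcard hL' (by omega)
  -- the vertex bound for every shadow, in particular the one supplied by `ShadowBirkhoff`
  have hexp : 18 * E ^ 2 + 4 ≤ (ℓ + c₂) ^ c₂ := hc₂ ℓ
  have hfinal : (Set.extremePoints ℝ (convexHull ℝ (L '' permMatrixPoints n))).ncard ≤
      2 ^ ((ℓ + c₂) ^ c₂) :=
    calc (Set.extremePoints ℝ (convexHull ℝ (L '' permMatrixPoints n))).ncard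
        ≤ 4 * (3 * formulaComplexity A + 1) := ncard_extremePoints_le_of_idealMember L A hA0 hAdvd
      _ ≤ 4 * (3 * 2 ^ (18 * E ^ 2) + 1) :=
          Nat.mul_le_mul_left 4 (Nat.add_le_add_right (Nat.mul_le_mul_left 3 hfc) 1)
      _ ≤ 2 ^ (18 * E ^ 2 + 4) := by
          have := Nat.one_le_two_pow (n := 18 * E ^ 2)
          rw [pow_add, show (2 : ℕ) ^ 4 = 16 by norm_num]
          omega
      _ ≤ 2 ^ ((ℓ + c₂) ^ c₂) := Nat.pow_le_pow_right Nat.two_pos hexp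
  exact absurd hL (not_lt.2 hfinal)

end Main

end Summit.ValiantsHypothesis.ValiantsHypothesis.Theorems.DivisionGap.PerCofactorDegreeReduction.ShadowCreationSplit

end
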